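/-
Copyright: the b2b-balaban cell (near-miss cell 7), T⁴-continuum fan-out; row NE7b swarm table S11, supplied by lineage
t4-ne7b-p2 (node U5c RENEWAL member, builder of the stability socket).  Released under the licence of the surrounding project.
-/
import Literature.MathematicalPhysics.QuantumFieldTheory.Balaban1983to89.T4StabilityFloorUnitary

/-!
# Row NE7b, leaf S11: the (B) junction — the stability socket's denominator half + the displayed numerator reading ⇒ `Regeneration`

Summits-side support leaf of the T⁴-continuum cell (rung (B)+1 on a FINITE torus only; NOT infinite volume, NOT the
mass gap, NOT the Clay statement; NOT a proof of the spine estimate NE7b).  Row NE7b of `HOME/BINDER-OWNERS.md`, claim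
table `t4/b2b-balaban-t4-ne7b-p1/LEAVES-NE7b.md` row S11 («G2 resummation + (B) junction»), supplied by the row's
co-owner #2 (lineage `t4-ne7b-p2`, generation 22) — the SAME object is consumed by both roads of the node: the COUNT
road's `HistorySocket.LiveHistories` ∕ S12 (two `Regeneration`s) and the RENEWAL road's
`RenewalAssembly.exists_relWeightBound_of_renewal` (two `LowEnvelope`s).  [folklore] composition BY NAME of the landed
socket `T4StabilitySocket.lowEnvelope_of_cor3With` ∕ `lowEnvelope_of_endStatementBPrinted` ∕
`T4StabilityFloorUnitary.lowEnvelope_of_cor3With_thm1_specialUnitary` with `T4StabilitySocket.regeneration_of_lowEnvelope`;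
no `def … : Prop` fact is minted (trigger condition c1), no `[cite:]` tag, nothing printed asserted.  (B) enters ONLY as
the displayed binder `B16.Cor3With` ∕ `B16.EndStatementBPrinted` (the cell's pin); H3 — the identification of Bałaban's
(1.104) terms with the abstract term family `T`, `A`, live-class map `π` — stays DISPLAYED: the numerator fields
`bad_subset`, (R3′) `up`, `dead_nonneg`, (RS) `resum`, `F_nonneg` are hypotheses over an ABSTRACT term family, exactly
as `T4LiveClassFibration.Regeneration` types them (the resummation sentence B16 p. 383 + (1.89) are their LOCATION, never
asserted here).

WHAT.  §1 `regeneration_of_cor3With` — ONE run with run-index map `κ` (the Cauchy pair uses `κ = id`, `κ = (· + 1)`):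
`Cor3With` + sign conventions + tuning `g_K = g` + the (α) reading binder + the NAMED floor (γ) `c₀ ≤ smallFieldMass` +
the site budget + an envelope bound `0 ≤ nup ≤ Nup` + the five numerator fields ⇒
`Regeneration l₀ π T A Bad′ dead F R (nlowOf l₀ B (max (em g) 0) n₁ c₀) nup (constOf l₀ B (max (em g) 0) n₁ c₀ Nup) K₀`.
§2 `regeneration_of_endStatementBPrinted` — the same from the pin `B16.EndStatementBPrinted` in its quantifier order
(`∃ γ₀ > 0, ∀ γ ≤ γ₀, ∀ g, ∃ Em ≥ 0, ∀ g₀ tuned, ∀ κ …`), and `regeneration_pair_of_endStatementBPrinted` — BOTH runs of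
the Cauchy pair (`κ = id` and `κ = (· + 1)`) with ONE constant `constOf l₀ B Em n₁ c₀ Nup` (common `g`, `B`, `n₁`, `c₀`,
`Nup`), which is what `T4LiveGasToTerms.exists_relWeightBound_of_regeneration_liveGas` ∕ `RenewalSlotGas` ∕ the count
exit ask.  §3 `regeneration_of_cor3With_thm1_specialUnitary` — the floor VALUED in `SU(N)` (R-U5c-GD's `c_low`
discharged modulo the model dictionary (D1)(D2)(D3′)(D3″), displayed).

HONEST DEPENDENCY (cell): continuum YM on T⁴ ⇐ BetaPertH ∧ nine spine estimates (0/9 proved); BetaPertH ⇐ (D1) ∧ (D4)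
∧ CAP+tail.  This file changes none of it.
-/

open MeasureTheory
open scoped BigOperators Matrix
open Literature.MathematicalPhysics.QuantumFieldTheory.Balaban1983to89
open Missing T4Continuum T4WeightBudget T4GlobalDenominator T4LiveClassFibration T4StabilitySocket T4StabilityFloor
open T4StabilityFloorUnitary B16ZLower

universe u

namespace Summit.QuantumFields.BalabanUV.T4Continuum.HistoryRegeneration

noncomputable section

/-! ## §1 One run: `Cor3With` + the socket binders + the displayed numerator reading ⇒ `Regeneration` -/

section OneRun

variable {F : T4Family} {G : Type*} [GaugeGroup G] [MeasurableSpace G] [HaarData G] [RegularGaugeGroup G]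

/-- **ROW S11, ONE RUN.**  Denominator: `T4StabilitySocket.lowEnvelope_of_cor3With` ((B) as the displayed binder
`B16.Cor3With`, sign conventions, tuning `g_K = g`, run-index map `κ`, a bounded measurable observable family, the (α)
READING binder `hα`, the NAMED floor (γ) `hfloor`, the site budget, the envelope bound).  Numerator (displayed, over an
ABSTRACT term family — H3 never minted): `bad_subset`, (R3′) `up : A ≤ dead·F·nup` on the bad fibres, `dead_nonneg`,
(RS) `resum : Σ_fibre dead ≤ R`, `F_nonneg`.  Conclusion: `Regeneration` with `nlow = nlowOf l₀ B (max (em g) 0) n₁ c₀`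
and `C = constOf l₀ B (max (em g) 0) n₁ c₀ Nup`. [folklore] -/
theorem regeneration_of_cor3With (D : FiniteEpsData F G) (hsign : B16.SignConventions D.C)
    {γB γ g : ℝ} {em ep : ℝ → ℝ} {g₀ : ℕ → ℝ} (hcor : B16.Cor3With D.C γB em ep) (hγ : γ ≤ γB)
    (htuned : D.Tuned γ g g₀) (κ : ℕ → ℕ)
    {obs : (K : ℕ) → GaugeField (F.P K) 0 G → ℝ} {B l₀ : ℝ}
    (hobs : ∀ K, Measurable (obs K)) (hbd : ∀ K U, |obs K U| ≤ B)
    {ι κc : Type*} [DecidableEq κc] {π : ℕ → ι → κc} {T : ℕ → Finset ι} {A : ℕ → ℝ → ι → ℝ}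
    {Bad' : ℕ → ℝ → Finset κc} {dead : ℕ → ℝ → ι → ℝ} {Fc R : ℕ → κc → ℝ} {K₀ : ℕ}
    -- (α) the H2/R2 reading binder: the run's full term sum dominates the dressed fine-lattice integral
    (hα : ∀ K t, |t| ≤ l₀ → K₀ ≤ K →
      ∫ U, Real.exp (t * obs (κ K) U) * D.dens (κ K) (g₀ (κ K)) 0 U ∂fieldMeasure (F.P (κ K)) 0 G ≤
        ∑ τ ∈ T K, A K t τ)
    -- (γ) the named floor and the site budget
    {c₀ n₁ : ℝ} (hc₀ : 0 < c₀) (hfloor : ∀ K, K₀ ≤ K → c₀ ≤ smallFieldMass D (κ K) (g₀ (κ K)))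
    (hsites : ∀ K, K₀ ≤ K → ((D.C ⟨κ K, F.m, g₀ (κ K)⟩).numSites (κ K) : ℝ) ≤ n₁)
    {nup : ℕ → ℝ → ℝ} {Nup : ℝ} (hnup : ∀ K t, |t| ≤ l₀ → K₀ ≤ K → 0 ≤ nup K t ∧ nup K t ≤ Nup)
    -- the displayed numerator reading (H3 displayed; (R3′), (RS))
    (bad_subset : ∀ K t, |t| ≤ l₀ → K₀ ≤ K → Bad' K t ⊆ classIndex π T K)
    (up : ∀ K t, |t| ≤ l₀ → K₀ ≤ K → ∀ c ∈ Bad' K t, ∀ τ ∈ fibre π T K c, A K t τ ≤ dead K t τ * Fc K c * nup K t)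
    (dead_nonneg : ∀ K t, |t| ≤ l₀ → K₀ ≤ K → ∀ c ∈ Bad' K t, ∀ τ ∈ fibre π T K c, 0 ≤ dead K t τ)
    (resum : ∀ K t, |t| ≤ l₀ → K₀ ≤ K → ∀ c ∈ Bad' K t, ∑ τ ∈ fibre π T K c, dead K t τ ≤ R K c)
    (F_nonneg : ∀ K t, |t| ≤ l₀ → K₀ ≤ K → ∀ c ∈ Bad' K t, 0 ≤ Fc K c) :
    Regeneration l₀ π T A Bad' dead Fc R (nlowOf l₀ B (max (em g) 0) n₁ c₀) nup
      (constOf l₀ B (max (em g) 0) n₁ c₀ Nup) K₀ :=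
  regeneration_of_lowEnvelope (lowEnvelope_of_cor3With D hsign hcor hγ htuned κ hobs hbd hα hc₀ hfloor hsites hnup)
    bad_subset up dead_nonneg resum F_nonneg

end OneRun

/-! ## §2 From the pin, in its quantifier order; the Cauchy pair with ONE constant -/

section Pin

variable {F : T4Family} {G : Type*} [GaugeGroup G] [MeasurableSpace G] [HaarData G] [RegularGaugeGroup G]

/-- **ROW S11 FROM THE PIN `B16.EndStatementBPrinted`** (the `T4ContinuumYM4Torus.ForSmallCouplings` quantifier order,
as `T4StabilitySocket.lowEnvelope_of_endStatementBPrinted`): `∃ γ₀ > 0, ∀ γ ≤ γ₀, ∀ g, ∃ Em ≥ 0, ∀ g₀` tuned, `∀ κ`,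
every abstract term family with the (α) binder, every named floor `c₀ > 0` with (γ) and the site budget, every envelope
`0 ≤ nup ≤ Nup`, and every displayed numerator reading ⇒ `Regeneration … (nlowOf l₀ B Em n₁ c₀) nup (constOf l₀ B Em n₁ c₀ Nup) K₀`.
The `Thm1Printed` conjunct of the pin is not used. [folklore] -/
theorem regeneration_of_endStatementBPrinted (D : FiniteEpsData F G) (hsign : B16.SignConventions D.C)
    (hB : B16.EndStatementBPrinted D.C)
    (obs : (K : ℕ) → GaugeField (F.P K) 0 G → ℝ) (B l₀ : ℝ)
    (hobs : ∀ K, Measurable (obs K)) (hbd : ∀ K U, |obs K U| ≤ B) :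
    ∃ γ₀ : ℝ, 0 < γ₀ ∧ ∀ γ g : ℝ, γ ≤ γ₀ → ∃ Em : ℝ, 0 ≤ Em ∧
      ∀ (g₀ : ℕ → ℝ), D.Tuned γ g g₀ → ∀ (κ : ℕ → ℕ) {ι κc : Type u} [DecidableEq κc] (π : ℕ → ι → κc)
        (T : ℕ → Finset ι) (A : ℕ → ℝ → ι → ℝ) (K₀ : ℕ),
        (∀ K t, |t| ≤ l₀ → K₀ ≤ K →
          ∫ U, Real.exp (t * obs (κ K) U) * D.dens (κ K) (g₀ (κ K)) 0 U ∂fieldMeasure (F.P (κ K)) 0 G ≤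
            ∑ τ ∈ T K, A K t τ) →
        ∀ (c₀ n₁ : ℝ), 0 < c₀ → (∀ K, K₀ ≤ K → c₀ ≤ smallFieldMass D (κ K) (g₀ (κ K))) →
          (∀ K, K₀ ≤ K → ((D.C ⟨κ K, F.m, g₀ (κ K)⟩).numSites (κ K) : ℝ) ≤ n₁) →
        ∀ (nup : ℕ → ℝ → ℝ) (Nup : ℝ), (∀ K t, |t| ≤ l₀ → K₀ ≤ K → 0 ≤ nup K t ∧ nup K t ≤ Nup) →
        ∀ (Bad' : ℕ → ℝ → Finset κc) (dead : ℕ → ℝ → ι → ℝ) (Fc R : ℕ → κc → ℝ),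
          (∀ K t, |t| ≤ l₀ → K₀ ≤ K → Bad' K t ⊆ classIndex π T K) →
          (∀ K t, |t| ≤ l₀ → K₀ ≤ K → ∀ c ∈ Bad' K t, ∀ τ ∈ fibre π T K c, A K t τ ≤ dead K t τ * Fc K c * nup K t) →
          (∀ K t, |t| ≤ l₀ → K₀ ≤ K → ∀ c ∈ Bad' K t, ∀ τ ∈ fibre π T K c, 0 ≤ dead K t τ) →
          (∀ K t, |t| ≤ l₀ → K₀ ≤ K → ∀ c ∈ Bad' K t, ∑ τ ∈ fibre π T K c, dead K t τ ≤ R K c) →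
          (∀ K t, |t| ≤ l₀ → K₀ ≤ K → ∀ c ∈ Bad' K t, 0 ≤ Fc K c) →
          Regeneration l₀ π T A Bad' dead Fc R (nlowOf l₀ B Em n₁ c₀) nup (constOf l₀ B Em n₁ c₀ Nup) K₀ := by
  obtain ⟨γB, hγB, em, ep, hcor⟩ := hB.2
  refine ⟨γB, hγB, fun γ g hγ => ⟨max (em g) 0, le_max_right _ _, ?_⟩⟩
  intro g₀ htuned κ ι κc _ π T A K₀ hα c₀ n₁ hc₀ hfloor hsites nup Nup hnup Bad' dead Fc R hbs hup hdn hrs hF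
  exact regeneration_of_cor3With D hsign hcor hγ htuned κ hobs hbd hα hc₀ hfloor hsites hnup hbs hup hdn hrs hF

/-- **THE CAUCHY PAIR WITH ONE CONSTANT.**  Two runs read off the same realisation at `κ K = K` (run A, `K` steps) and
`κ K = K + 1` (run B, `K + 1` steps), same `γ`, `g`, observable bound `B`, site budget `n₁`, floor `c₀` and envelope
bound `Nup` ⇒ two `Regeneration`s with THE SAME `nlow = nlowOf l₀ B (max (em g) 0) n₁ c₀` and THE SAME constant
`constOf l₀ B (max (em g) 0) n₁ c₀ Nup` — the common `C` that `exists_relWeightBound_of_regeneration_liveGas` ∕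
`RenewalSlotGas.exists_relWeightBound_of_slotMasses` ∕ the count exit ask. [folklore] -/
theorem regeneration_pair_of_cor3With (D : FiniteEpsData F G) (hsign : B16.SignConventions D.C)
    {γB γ g : ℝ} {em ep : ℝ → ℝ} {g₀ : ℕ → ℝ} (hcor : B16.Cor3With D.C γB em ep) (hγ : γ ≤ γB)
    (htuned : D.Tuned γ g g₀)
    {obs : (K : ℕ) → GaugeField (F.P K) 0 G → ℝ} {B l₀ : ℝ}
    (hobs : ∀ K, Measurable (obs K)) (hbd : ∀ K U, |obs K U| ≤ B)
    {ι κc : Type*} [DecidableEq κc] {π : ℕ → ι → κc} {T : ℕ → Finset ι} {A A' : ℕ → ℝ → ι → ℝ}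
    {Bad' : ℕ → ℝ → Finset κc} {dead dead' : ℕ → ℝ → ι → ℝ} {Fc R Fc' R' : ℕ → κc → ℝ} {K₀ : ℕ}
    (hα : ∀ K t, |t| ≤ l₀ → K₀ ≤ K →
      ∫ U, Real.exp (t * obs K U) * D.dens K (g₀ K) 0 U ∂fieldMeasure (F.P K) 0 G ≤ ∑ τ ∈ T K, A K t τ)
    (hα' : ∀ K t, |t| ≤ l₀ → K₀ ≤ K →
      ∫ U, Real.exp (t * obs (K + 1) U) * D.dens (K + 1) (g₀ (K + 1)) 0 U ∂fieldMeasure (F.P (K + 1)) 0 G ≤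
        ∑ τ ∈ T K, A' K t τ)
    {c₀ n₁ : ℝ} (hc₀ : 0 < c₀) (hfloor : ∀ K, K₀ ≤ K → c₀ ≤ smallFieldMass D K (g₀ K))
    (hfloor' : ∀ K, K₀ ≤ K → c₀ ≤ smallFieldMass D (K + 1) (g₀ (K + 1)))
    (hsites : ∀ K, K₀ ≤ K → ((D.C ⟨K, F.m, g₀ K⟩).numSites K : ℝ) ≤ n₁)
    (hsites' : ∀ K, K₀ ≤ K → ((D.C ⟨K + 1, F.m, g₀ (K + 1)⟩).numSites (K + 1) : ℝ) ≤ n₁)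
    {nup mup : ℕ → ℝ → ℝ} {Nup : ℝ} (hnup : ∀ K t, |t| ≤ l₀ → K₀ ≤ K → 0 ≤ nup K t ∧ nup K t ≤ Nup)
    (hmup : ∀ K t, |t| ≤ l₀ → K₀ ≤ K → 0 ≤ mup K t ∧ mup K t ≤ Nup)
    (bad_subset : ∀ K t, |t| ≤ l₀ → K₀ ≤ K → Bad' K t ⊆ classIndex π T K)
    (up : ∀ K t, |t| ≤ l₀ → K₀ ≤ K → ∀ c ∈ Bad' K t, ∀ τ ∈ fibre π T K c, A K t τ ≤ dead K t τ * Fc K c * nup K t)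
    (dead_nonneg : ∀ K t, |t| ≤ l₀ → K₀ ≤ K → ∀ c ∈ Bad' K t, ∀ τ ∈ fibre π T K c, 0 ≤ dead K t τ)
    (resum : ∀ K t, |t| ≤ l₀ → K₀ ≤ K → ∀ c ∈ Bad' K t, ∑ τ ∈ fibre π T K c, dead K t τ ≤ R K c)
    (F_nonneg : ∀ K t, |t| ≤ l₀ → K₀ ≤ K → ∀ c ∈ Bad' K t, 0 ≤ Fc K c)
    (up' : ∀ K t, |t| ≤ l₀ → K₀ ≤ K → ∀ c ∈ Bad' K t, ∀ τ ∈ fibre π T K c, A' K t τ ≤ dead' K t τ * Fc' K c * mup K t)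
    (dead'_nonneg : ∀ K t, |t| ≤ l₀ → K₀ ≤ K → ∀ c ∈ Bad' K t, ∀ τ ∈ fibre π T K c, 0 ≤ dead' K t τ)
    (resum' : ∀ K t, |t| ≤ l₀ → K₀ ≤ K → ∀ c ∈ Bad' K t, ∑ τ ∈ fibre π T K c, dead' K t τ ≤ R' K c)
    (F'_nonneg : ∀ K t, |t| ≤ l₀ → K₀ ≤ K → ∀ c ∈ Bad' K t, 0 ≤ Fc' K c) :
    Regeneration l₀ π T A Bad' dead Fc R (nlowOf l₀ B (max (em g) 0) n₁ c₀) nup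
        (constOf l₀ B (max (em g) 0) n₁ c₀ Nup) K₀ ∧
      Regeneration l₀ π T A' Bad' dead' Fc' R' (nlowOf l₀ B (max (em g) 0) n₁ c₀) mup
        (constOf l₀ B (max (em g) 0) n₁ c₀ Nup) K₀ :=
  ⟨regeneration_of_cor3With D hsign hcor hγ htuned id hobs hbd hα hc₀ hfloor hsites hnup bad_subset up dead_nonneg
      resum F_nonneg,
    regeneration_of_cor3With D hsign hcor hγ htuned (· + 1) hobs hbd hα' hc₀ hfloor' hsites' hmup bad_subset up'
      dead'_nonneg resum' F'_nonneg⟩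

end Pin

/-! ## §3 The floor VALUED in `SU(N)` (the model dictionary displayed) -/

section SpecialUnitary

variable {N : ℕ} [NeZero N] {F : T4Family}

/-- **ROW S11 WITH THE FLOOR VALUED** (`SU(N)`, Theorem-1 form of the dictionary):
`T4StabilityFloorUnitary.lowEnvelope_of_cor3With_thm1_specialUnitary` (floor
`floorOf g (½(B₃ε₁)²·6(2L^m)^4) (haar(suOpBall N τ)^{unitBondCount F})`, a closed form — no named `c₀` left; the
dictionary DATA `uK`∕`uLoc`∕`nbhd` and binders (D1) `hchi`, (D2) `hwil`, (D3″) `hregLoc`, (D3′) `hreg`, orders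
`4τ < ε₁`, `B₃ε₁ ≤ ε_K` displayed) + the numerator reading ⇒ `Regeneration`. [folklore] -/
theorem regeneration_of_cor3With_thm1_specialUnitary
    (D : FiniteEpsData F (Matrix.specialUnitaryGroup (Fin N) ℂ)) (hsign : B16.SignConventions D.C)
    {γB γ g : ℝ} {em ep : ℝ → ℝ} {g₀ : ℕ → ℝ} (hcor : B16.Cor3With D.C γB em ep) (hγ : γ ≤ γB)
    (htuned : D.Tuned γ g g₀) (κ : ℕ → ℕ)
    {obs : (K : ℕ) → GaugeField (F.P K) 0 (Matrix.specialUnitaryGroup (Fin N) ℂ) → ℝ} {B l₀ : ℝ}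
    (hobs : ∀ K, Measurable (obs K)) (hbd : ∀ K U, |obs K U| ≤ B)
    {ι κc : Type*} [DecidableEq κc] {π : ℕ → ι → κc} {T : ℕ → Finset ι} {A : ℕ → ℝ → ι → ℝ}
    {Bad' : ℕ → ℝ → Finset κc} {dead : ℕ → ℝ → ι → ℝ} {Fc R : ℕ → κc → ℝ} {K₀ : ℕ}
    (hα : ∀ K t, |t| ≤ l₀ → K₀ ≤ K →
      ∫ U, Real.exp (t * obs (κ K) U) * D.dens (κ K) (g₀ (κ K)) 0 U
          ∂fieldMeasure (F.P (κ K)) 0 (Matrix.specialUnitaryGroup (Fin N) ℂ) ≤ ∑ τ ∈ T K, A K t τ)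
    {τ : ℝ} (hτ : 0 < τ)
    (uK : (K : ℕ) → GaugeField (F.P (κ K)) (κ K) (Matrix.specialUnitaryGroup (Fin N) ℂ) →
      GaugeField (F.P (κ K)) 0 (Matrix.specialUnitaryGroup (Fin N) ℂ))
    {Box : ℕ → Type*}
    (uLoc : (K : ℕ) → GaugeField (F.P (κ K)) (κ K) (Matrix.specialUnitaryGroup (Fin N) ℂ) → Box K →
      GaugeField (F.P (κ K)) 0 (Matrix.specialUnitaryGroup (Fin N) ℂ))
    (nbhd : (K : ℕ) → Box K → Set (Plaq (F.P (κ K)) 0))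
    {εK : ℕ → ℝ} {B₃ ε₁ n₁ : ℝ}
    (hchi : ∀ K, K₀ ≤ K → ∀ V,
      (∀ c, ∀ p ∈ nbhd K c, dist1 (GaugeField.plaqHol (uLoc K V c) p) < εK K * (F.P (κ K)).eta (κ K) ^ 2) →
      (D.C ⟨κ K, F.m, g₀ (κ K)⟩).χ (κ K) ((D.real.cfg (κ K) (g₀ (κ K)) (κ K)).symm V) = 1)
    (hwil : ∀ K, K₀ ≤ K → ∀ V,
      (D.C ⟨κ K, F.m, g₀ (κ K)⟩).wilsonBG (κ K) ((D.real.cfg (κ K) (g₀ (κ K)) (κ K)).symm V) = wilsonAction4 (uK K V))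
    (hregLoc : ∀ K, K₀ ≤ K → ∀ V : GaugeField (F.P (κ K)) (κ K) (Matrix.specialUnitaryGroup (Fin N) ℂ),
      PlaqSmall ε₁ V → ∀ c, ∀ p ∈ nbhd K c,
        dist1 (GaugeField.plaqHol (uLoc K V c) p) < B₃ * ε₁ * (F.P (κ K)).eta (κ K) ^ 2)
    (hreg : ∀ K, K₀ ≤ K → ∀ V : GaugeField (F.P (κ K)) (κ K) (Matrix.specialUnitaryGroup (Fin N) ℂ),
      PlaqSmall ε₁ V → PlaqSmall (B₃ * ε₁ * (F.P (κ K)).eta (κ K) ^ 2) (uK K V))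
    (h4τ : 4 * τ < ε₁) (hε : ∀ K, K₀ ≤ K → B₃ * ε₁ ≤ εK K)
    (hsites : ∀ K, K₀ ≤ K → ((D.C ⟨κ K, F.m, g₀ (κ K)⟩).numSites (κ K) : ℝ) ≤ n₁)
    {nup : ℕ → ℝ → ℝ} {Nup : ℝ} (hnup : ∀ K t, |t| ≤ l₀ → K₀ ≤ K → 0 ≤ nup K t ∧ nup K t ≤ Nup)
    (bad_subset : ∀ K t, |t| ≤ l₀ → K₀ ≤ K → Bad' K t ⊆ classIndex π T K)
    (up : ∀ K t, |t| ≤ l₀ → K₀ ≤ K → ∀ c ∈ Bad' K t, ∀ τ' ∈ fibre π T K c, A K t τ' ≤ dead K t τ' * Fc K c * nup K t)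
    (dead_nonneg : ∀ K t, |t| ≤ l₀ → K₀ ≤ K → ∀ c ∈ Bad' K t, ∀ τ' ∈ fibre π T K c, 0 ≤ dead K t τ')
    (resum : ∀ K t, |t| ≤ l₀ → K₀ ≤ K → ∀ c ∈ Bad' K t, ∑ τ' ∈ fibre π T K c, dead K t τ' ≤ R K c)
    (F_nonneg : ∀ K t, |t| ≤ l₀ → K₀ ≤ K → ∀ c ∈ Bad' K t, 0 ≤ Fc K c) :
    Regeneration l₀ π T A Bad' dead Fc R
      (nlowOf l₀ B (max (em g) 0) n₁
        (floorOf g (1 / 2 * (B₃ * ε₁) ^ 2 * (6 * (2 * (F.L : ℝ) ^ F.m) ^ 4))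
          ((HaarData.haar : Measure (Matrix.specialUnitaryGroup (Fin N) ℂ)).real (suOpBall N τ) ^ unitBondCount F))) nup
      (constOf l₀ B (max (em g) 0) n₁
        (floorOf g (1 / 2 * (B₃ * ε₁) ^ 2 * (6 * (2 * (F.L : ℝ) ^ F.m) ^ 4))
          ((HaarData.haar : Measure (Matrix.specialUnitaryGroup (Fin N) ℂ)).real (suOpBall N τ) ^ unitBondCount F)) Nup)
      K₀ :=
  regeneration_of_lowEnvelope
    (lowEnvelope_of_cor3With_thm1_specialUnitary D hsign hcor hγ htuned κ hobs hbd hα hτ uK uLoc nbhd hchi hwil hregLoc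
      hreg h4τ hε hsites hnup)
    bad_subset up dead_nonneg resum F_nonneg

end SpecialUnitary

end

end Summit.QuantumFields.BalabanUV.T4Continuum.HistoryRegeneration
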